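import Literature.Topology.FourManifolds.PiStableFourCollapse
import Literature.AlgebraicTopology.Homotopy.SphereMapsHomotopyGroups
import HarnessLib

/-!
# `Π₄ = 0` in Mathlib's vocabulary: the named fact `piStable_four_trivial` is `π₄₊ₖ(Sᵏ) = 0`, `k > 5`

Topic `Literature/Topology/FourManifolds`, sibling of `PiStableFourCollapse.lean`. That file vendors
Kervaire–Milnor's `Π₄ = 0` (*Groups of homotopy spheres I*, Ann. of Math. 77 (1963), §4, p. 510:
"the stable homotopy group `Πₙ = πₙ₊ₖ(Sᵏ)`", `k > n + 1`; table p. 512, column `n = 4`) as the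
named fact `Literature.Topology.FourManifolds.piStable_four_trivial`, read on the carrier of the
tree's Pontryagin–Thom collapse maps: every continuous `S⁴⁺ᵏ → ℝᵏ ∪ {∞}`, `k > 5`, is (freely)
homotopic to the constant map `∞`. This file PROVES that this reading is EQUIVALENT to the
statement in Mathlib's own homotopy-group vocabulary,

  `∀ k > 5, ∀ x, Subsingleton (π_ (4 + k) Sᵏ x)`, `π_ n X x = HomotopyGroup (Fin n) X x`,

`Sᵏ` the Euclidean unit sphere — so that the named fact is exactly the printed `Π₄ = 0` (in
particular not stronger), and a computation of the `4`-stem stated for Mathlib's `HomotopyGroup`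
discharges it directly:

* `piStable_four_trivial_of_subsingleton_homotopyGroup`: `π₄₊ₖ(Sᵏ) = 0` (all base points,
  `k > 5`) ⟹ `piStable_four_trivial`;
* `subsingleton_homotopyGroup_of_piStable_four_trivial`: the converse;
* `piStable_four_trivial_iff_subsingleton_homotopyGroup`: the equivalence.

The dictionary between maps of spheres and cube classes is the proved file
`Literature/AlgebraicTopology/Homotopy/SphereMapsHomotopyGroups.lean` (Hatcher, *Algebraic Topology*
(2002), §4.1, p. 346: for path-connected `X`, "every map `Sⁱ → X` is homotopic to a constant map"
iff "`πᵢ(X, x₀) = 0` for all `x₀`"), together with `ℝᵏ ∪ {∞} ≅ Sᵏ`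
(`onePointEuclideanHomeomorphSphere`) and the homotopy invariance of the vanishing of `π_N`
(`subsingleton_homotopyGroup_of_homotopyEquiv`). Everything here is proved; no definitions, no
named facts.

## References

* M. Kervaire, J. Milnor, *Groups of homotopy spheres I*, Ann. of Math. (2) 77 (1963), 504–537:
  §4, p. 510 (`Πₙ = πₙ₊ₖ(Sᵏ)`, `k > n + 1`), table p. 512 (`Π₄ = 0`). doi:10.2307/1970128
  [KervaireMilnorAnnals1963]
* A. Hatcher, *Algebraic Topology*, CUP (2002), §4.1, p. 346 (equivalent conditions for
  `πᵢ = 0`). [HatcherAT2002]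
-/

noncomputable section

namespace Literature.Topology.FourManifolds

open Literature.AlgebraicTopology.Homotopy
open scoped _root_.Topology _root_.Topology.Homotopy

/-- **`Π₄ = 0` from `π₄₊ₖ(Sᵏ) = 0` in Mathlib's vocabulary.** If Mathlib's homotopy group
`π_ (4 + k) Sᵏ x = HomotopyGroup (Fin (4 + k)) Sᵏ x` of the Euclidean unit sphere `Sᵏ` is trivial
for every `k > 5` and every base point `x`, then the named fact `piStable_four_trivial` holds:
every continuous `S⁴⁺ᵏ → ℝᵏ ∪ {∞}`, `k > 5`, is homotopic to the constant map `∞`. Proof: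
`ℝᵏ ∪ {∞} ≅ Sᵏ` (`onePointEuclideanHomeomorphSphere`) is path connected
(`pathConnectedSpace_onePoint_euclideanSpace`) and has the same, trivial, `π_ (4 + k)`
(`subsingleton_homotopyGroup_of_homotopyEquiv`), and maps of spheres into a path-connected space
with `π₄₊ₖ = 0` at every base point are homotopic to any constant
(`homotopic_const_of_sphere_of_subsingleton_homotopyGroup`; Hatcher 2002, §4.1, p. 346). This is
the direction a computation of the stable stem `π₄₊ₖ(Sᵏ) = 0` (Kervaire–Milnor 1963, table p. 512;
Serre, Toda) stated for Mathlib's `HomotopyGroup` would feed.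
[cite: KervaireMilnorAnnals1963, §4, p. 510 and table p. 512 (Π₄ = 0); HatcherAT2002, §4.1 (p. 346)] -/
theorem piStable_four_trivial_of_subsingleton_homotopyGroup
    (h : ∀ k : ℕ, 5 < k → ∀ x : Metric.sphere (0 : EuclideanSpace ℝ (Fin (k + 1))) 1,
      Subsingleton (π_ (4 + k) (Metric.sphere (0 : EuclideanSpace ℝ (Fin (k + 1))) 1) x)) :
    piStable_four_trivial := by
  intro k hk f
  haveI : PathConnectedSpace (OnePoint (EuclideanSpace ℝ (Fin k))) :=
    pathConnectedSpace_onePoint_euclideanSpace (by omega)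
  have hπ : 1 ≤ 4 + k → ∀ y : OnePoint (EuclideanSpace ℝ (Fin k)),
      Subsingleton (π_ (4 + k) (OnePoint (EuclideanSpace ℝ (Fin k))) y) :=
    fun _ y => subsingleton_homotopyGroup_of_homotopyEquiv
      (onePointEuclideanHomeomorphSphere k).toHomotopyEquiv (h k hk) y
  exact homotopic_const_of_sphere_of_subsingleton_homotopyGroup
    (E := EuclideanSpace ℝ (Fin (4 + k + 1))) (m := 4 + k) finrank_euclideanSpace_fin hπ f
    OnePoint.infty

/-- **`π₄₊ₖ(Sᵏ) = 0` in Mathlib's vocabulary from `Π₄ = 0`.** Conversely, the named fact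
`piStable_four_trivial` implies that `π_ (4 + k) Sᵏ x` is trivial for every `k > 5` and every
base point `x` of the Euclidean unit sphere: every map `S⁴⁺ᵏ → ℝᵏ ∪ {∞}` being null-homotopic,
`π_ (4 + k) (ℝᵏ ∪ {∞}) = 0` at every base point
(`subsingleton_homotopyGroup_of_sphereMaps_nullhomotopic`: cube classes factor through
`I⁴⁺ᵏ/∂I⁴⁺ᵏ ≅ S⁴⁺ᵏ`, and free null-homotopies give based ones), and `ℝᵏ ∪ {∞} ≅ Sᵏ`.
[cite: KervaireMilnorAnnals1963, §4, p. 510 and table p. 512 (Π₄ = 0); HatcherAT2002, §4.1 (p. 346)] -/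
theorem subsingleton_homotopyGroup_of_piStable_four_trivial (h : piStable_four_trivial)
    {k : ℕ} (hk : 5 < k) (x : Metric.sphere (0 : EuclideanSpace ℝ (Fin (k + 1))) 1) :
    Subsingleton (π_ (4 + k) (Metric.sphere (0 : EuclideanSpace ℝ (Fin (k + 1))) 1) x) := by
  have hY : ∀ y : OnePoint (EuclideanSpace ℝ (Fin k)),
      Subsingleton (π_ (4 + k) (OnePoint (EuclideanSpace ℝ (Fin k))) y) :=
    subsingleton_homotopyGroup_of_sphereMaps_nullhomotopic (N := 4 + k)
      fun g => ⟨OnePoint.infty, h k hk g⟩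
  exact subsingleton_homotopyGroup_of_homotopyEquiv
    (onePointEuclideanHomeomorphSphere k).symm.toHomotopyEquiv hY x

/-- **The named fact `Π₄ = 0` is exactly `π₄₊ₖ(Sᵏ) = 0`, `k > 5`, for Mathlib's homotopy groups**
of the Euclidean unit spheres, at all base points (Kervaire–Milnor 1963, §4: "the stable homotopy
group `Πₙ = πₙ₊ₖ(Sᵏ)`", `k > n + 1`; `Π₄ = 0`, table p. 512): the conjunction of
`piStable_four_trivial_of_subsingleton_homotopyGroup` and
`subsingleton_homotopyGroup_of_piStable_four_trivial`.
[cite: KervaireMilnorAnnals1963, §4, p. 510 and table p. 512 (Π₄ = 0)] -/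
theorem piStable_four_trivial_iff_subsingleton_homotopyGroup :
    piStable_four_trivial ↔ ∀ k : ℕ, 5 < k → ∀ x : Metric.sphere (0 : EuclideanSpace ℝ (Fin (k + 1))) 1,
      Subsingleton (π_ (4 + k) (Metric.sphere (0 : EuclideanSpace ℝ (Fin (k + 1))) 1) x) :=
  ⟨fun h _ hk x => subsingleton_homotopyGroup_of_piStable_four_trivial h hk x,
    piStable_four_trivial_of_subsingleton_homotopyGroup⟩

end Literature.Topology.FourManifolds

end
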